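import Literature.Geometry.Lorentzian.ReggeWheelerChannels
import HarnessLib

/-!
# Radiation fields of `ψ_tt − ψ_xx + V(x)ψ = 0` on the line: profiles at the two null ends,
# asymptotic completeness as a predicate, and the distorted-Fourier radiation integral

Topic `Literature/Analysis/ODE` (namespace `Literature.Analysis.ODE.Scattering1D`), the time-dependent
companion of `JostScattering1D.lean`, written over the wave vocabulary of
`Literature.Geometry.Lorentzian.ReggeWheelerChannels` (`energyDensity`, `totalEnergy`,
`exteriorEnergy`, `channelEnergy`, `IsSolution`; time first, `deriv` slices, energies in `ℝ≥0∞`).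

**Radiation profiles.**  A finite-energy wave on the line with a decaying potential is, for late
times and in energy norm, a free wave: a right-mover plus a left-mover.  We record the two movers by
the profiles of their TIME DERIVATIVE along the null coordinates `u = t − x` (right end, `𝓘⁺` of the
tortoise line) and `v = t + x` (left end, `𝓗⁺`): the free comparison field with profiles `(G₊, G₋)`
has `∂ₜ = G₊(t − x) + G₋(t + x)`, `∂ₓ = −G₊(t − x) + G₋(t + x)` (`freeVelocity`, `freeGradient`) and
energy density exactly `2 G₊(t − x)² + 2 G₋(t + x)²` (`freeVelocity_sq_add_freeGradient_sq`).  In one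
space dimension this is the Lax–Phillips translation representation read through d'Alembert's
formula (Lax–Phillips, Ch. I §5: the outgoing representer of `u = a(t + x) + b(t − x)` is `b′`, and
`E = ∫ (a′)² + (b′)²` in their normalisation `E = ½∫(u_x² + u_t²)`); in higher dimensions it is
Friedlander's radiation field.

* `radiationDefect V ψ G₊ G₋ t = ∫ (ψ_t − ∂ₜΦ)² + (ψ_x − ∂ₓΦ)² + V ψ² dx ∈ ℝ≥0∞` — the energy-norm
  distance at time `t` between `ψ` and the free field `Φ` with profiles `(G₊, G₋)` (the potential
  energy of `ψ` itself is part of the defect: radiation carries kinetic + gradient energy only).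
* `RadiationFieldRepresentation1D V ψ G₊ G₋` — **`(G₊, G₋) ∈ L² × L²` are the forward radiation
  profiles of `ψ`**: `radiationDefect → 0` as `t → +∞`.  This is asymptotic completeness FOR `ψ`, in
  the first-order energy variables; the profiles toward the past are those of `(t, x) ↦ ψ(−t, x)`.
* `profileEnergy G s = ∫_{s} 2 G² ∈ ℝ≥0∞` — the energy radiated through the window `s` of the null
  coordinate; `AsymptoticallyComplete V` — the PREDICATE "every finite-energy global `C²` solution of
  `ψ_tt − ψ_xx + Vψ = 0` has forward radiation profiles" (for the Regge–Wheeler potentials this is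
  the mode-by-mode content of Dimock–Kay's asymptotic completeness on Schwarzschild, Ann. Phys. 175
  (1987); for `∫(1+|x|)|V| < ∞` without bound states it follows from the distorted Plancherel theorem
  of Deift–Trubowitz §2 / Marchenko Ch. 3 §5).  NO CLAIM is made here: statements take
  `(h : AsymptoticallyComplete V)` or a representation as a hypothesis.  The energy identities that
  follow from a representation — `totalEnergy V ψ t → 2‖G₊‖² + 2‖G₋‖²` and
  `exteriorEnergy V xc a ψ t → 2∫_{u < −(a+xc)} G₊² + 2∫_{v < xc−a} G₋²` as `t → +∞`, whence
  `channelEnergy V xc a ψ atTop` — are theorems of `RadiationField1DEnergy.lean`.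
* The **distorted-Fourier radiation integral** `radiationIntegral c θ u = Z(u) = ∫ c(ω) e^{i(θ(ω) − ωu)} dω`
  of a real spectral density `c` (meant to vanish for `ω ≤ 0`) against a real phase `θ` — the shape in
  which `G₊` appears when time-symmetric data are expanded in standing waves `cos(ωx + θ(ω))` of
  the stationary problem (`IsReflectionPhase` of `JostScattering1D.lean`): formally, in the
  idealisation of total reflection (`|R₊| = 1`), time-even data `(ψ₀, 0)` expanded as
  `ψ₀ = ∫ c̃(ω) cos(ωx + θ(ω)) dω` radiate `G₊ = Im Z` with `c = ω c̃/π`, and time-odd data radiate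
  `Re Z` (a heuristic recorded for orientation only — the transmitted part and the zone where the
  eigenfunctions are not yet standing waves are ignored; nothing of it is asserted).  What IS proved
  is the bookkeeping behind "caught energy `= A ∓ B`": with the **windowed norm**
  `windowedNorm Z u₀ = A(u₀) = ∫_{u ≤ u₀} ‖Z‖²` and the **windowed interference**
  `windowedInterference Z u₀ = B(u₀) = Re ∫_{u ≤ u₀} Z²`, one has `2∫_{u≤u₀}(Im Z)² = A − B` and
  `2∫_{u≤u₀}(Re Z)² = A + B` (`two_mul_integral_im_sq`, `two_mul_integral_re_sq`).

Deliberately NOT here: existence of profiles (asymptotic completeness is a hypothesis), the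
distorted Fourier transform as an operator and its Plancherel theorem, pointwise (Friedlander)
limits along null lines, decay rates.

## References
* P. D. Lax, R. S. Phillips, *Scattering Theory*, Academic Press (1967), Ch. I §5 (translation
  representation of the string; energy `= ∫` (representer)²). Key `LaxPhillips1967`.
* J. Dimock, B. S. Kay, Ann. Phys. 175 (1987) 366–426 (classical scattering and asymptotic
  completeness for the mode-reduced wave equation on Schwarzschild). Key `DimockKay1987`.
* V. A. Marchenko, *Sturm–Liouville Operators and Applications* (2011), Ch. 3 §5; P. Deift,
  E. Trubowitz, CPAM 32 (1979), §2. Keys `Marchenko2011`, `DeiftTrubowitz1979`.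
* C. Kenig, A. Lawrie, B. Liu, W. Schlag, Adv. Math. 285 (2015), §§2–3 (exterior energy of free
  radial waves through radiation profiles). Key `KenigEtAl2015`.
-/

noncomputable section

open Set Filter MeasureTheory
open scoped ENNReal Topology

namespace Literature.Analysis.ODE

namespace Scattering1D

open Literature.Geometry.Lorentzian.ReggeWheeler

/-! ### The free comparison field of a profile pair -/

/-- Time derivative of the free field with radiation profiles `(G₊, G₋)`:
`∂ₜ[F(t − x) + H(t + x)] = G₊(t − x) + G₋(t + x)` (`F′ = G₊`, `H′ = G₋`). [cite: LaxPhillips1967, Ch. I §5 (5.5)] -/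
def freeVelocity (Gp Gm : ℝ → ℝ) (t x : ℝ) : ℝ := Gp (t - x) + Gm (t + x)

/-- Space derivative of the free field with radiation profiles `(G₊, G₋)`:
`∂ₓ[F(t − x) + H(t + x)] = −G₊(t − x) + G₋(t + x)`. [cite: LaxPhillips1967, Ch. I §5 (5.5)] -/
def freeGradient (Gp Gm : ℝ → ℝ) (t x : ℝ) : ℝ := -Gp (t - x) + Gm (t + x)

/-- **The free energy density splits**: `(∂ₜΦ)² + (∂ₓΦ)² = 2 G₊(t − x)² + 2 G₋(t + x)²` pointwise — the
cross terms cancel, so right- and left-movers carry their energies separately.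
[cite: LaxPhillips1967, Ch. I §5 (5.9)] -/
theorem freeVelocity_sq_add_freeGradient_sq (Gp Gm : ℝ → ℝ) (t x : ℝ) :
    freeVelocity Gp Gm t x ^ 2 + freeGradient Gp Gm t x ^ 2 =
      2 * Gp (t - x) ^ 2 + 2 * Gm (t + x) ^ 2 := by
  unfold freeVelocity freeGradient
  ring

/-- d'Alembert: if `F′ = G₊` and `H′ = G₋` then `Φ(t, x) = F(t − x) + H(t + x)` has
`∂ₜΦ = freeVelocity G₊ G₋` and `∂ₓΦ = freeGradient G₊ G₋`. [cite: LaxPhillips1967, Ch. I §5 (5.5)] -/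
theorem hasDerivAt_free {F H Gp Gm : ℝ → ℝ} (hF : ∀ s, HasDerivAt F (Gp s) s)
    (hH : ∀ s, HasDerivAt H (Gm s) s) (t x : ℝ) :
    HasDerivAt (fun τ ↦ F (τ - x) + H (τ + x)) (freeVelocity Gp Gm t x) t ∧
      HasDerivAt (fun y ↦ F (t - y) + H (t + y)) (freeGradient Gp Gm t x) x := by
  constructor
  · have h1 : HasDerivAt (fun τ ↦ F (τ - x)) (Gp (t - x) * 1) t :=
      (hF (t - x)).comp t ((hasDerivAt_id t).sub_const x)
    have h2 : HasDerivAt (fun τ ↦ H (τ + x)) (Gm (t + x) * 1) t :=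
      (hH (t + x)).comp t ((hasDerivAt_id t).add_const x)
    exact (h1.add h2).congr_deriv (by unfold freeVelocity; ring)
  · have h1 : HasDerivAt (fun y ↦ F (t - y)) (Gp (t - x) * -1) x :=
      (hF (t - x)).comp x ((hasDerivAt_id x).const_sub t)
    have h2 : HasDerivAt (fun y ↦ H (t + y)) (Gm (t + x) * 1) x :=
      (hH (t + x)).comp x ((hasDerivAt_id x).const_add t)
    exact (h1.add h2).congr_deriv (by unfold freeGradient; ring)

/-! ### Radiation profiles of a wave with potential -/

variable (V : ℝ → ℝ)

/-- The **radiation defect** of `ψ` against the profile pair `(G₊, G₋)` at time `t`: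
`∫ (ψ_t − G₊(t−x) − G₋(t+x))² + (ψ_x + G₊(t−x) − G₋(t+x))² + V(x) ψ(t,x)² dx ∈ [0, ∞]` — the squared
energy-norm distance between `ψ(t)` and the free field with profiles `(G₊, G₋)` (for `V ≥ 0`; the
potential energy of `ψ` is counted in full). [folklore] -/
def radiationDefect (ψ : ℝ → ℝ → ℝ) (Gp Gm : ℝ → ℝ) (t : ℝ) : ℝ≥0∞ :=
  ∫⁻ x, ENNReal.ofReal ((deriv (fun τ ↦ ψ τ x) t - freeVelocity Gp Gm t x) ^ 2 +
    (deriv (ψ t) x - freeGradient Gp Gm t x) ^ 2 + V x * ψ t x ^ 2)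

/-- **Radiation-field representation** of `ψ` (forward in time): `G₊, G₋ ∈ L²(ℝ)` and the radiation
defect of `ψ` against `(G₊, G₋)` tends to `0` as `t → +∞` — `ψ` is asymptotically the free wave whose
time derivative is `G₊(t − x) + G₋(t + x)`; `G₊` (a function of `u = t − x`) is the profile radiated
to the right end, `G₋` (a function of `v = t + x`) the one radiated to the left end.  The Lax–Phillips
outgoing translation representer in one dimension; the past profiles are those of `ψ(−t, x)`.
[cite: LaxPhillips1967, Ch. I §5] -/
structure RadiationFieldRepresentation1D (ψ : ℝ → ℝ → ℝ) (Gp Gm : ℝ → ℝ) : Prop where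
  memLp_right : MemLp Gp 2
  memLp_left : MemLp Gm 2
  tendsto_radiationDefect : Tendsto (radiationDefect V ψ Gp Gm) atTop (𝓝 0)

/-- The **energy radiated through the window `s`** of the null coordinate by the profile `G`:
`∫_s 2 G² ∈ [0, ∞]` (the factor `2`: a mover `F(t ∓ x)` has energy density `2F′²`). [folklore] -/
def profileEnergy (G : ℝ → ℝ) (s : Set ℝ) : ℝ≥0∞ := ∫⁻ u in s, ENNReal.ofReal (2 * G u ^ 2)

/-- **Asymptotic completeness** of `ψ_tt − ψ_xx + Vψ = 0`, as a predicate on the potential: every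
global `C²` solution of finite energy admits a (forward) radiation-field representation.  No claim
is made; for `V ≥ 0` of the Regge–Wheeler class this is the content of Dimock–Kay's theorem, taken
as a hypothesis `(h : AsymptoticallyComplete V)` where needed.  (A predicate ON THE POTENTIAL — the
binder is explicit so that it is not read as a closed named fact.) [folklore] -/
def AsymptoticallyComplete (W : ℝ → ℝ) : Prop :=
  ∀ ψ : ℝ → ℝ → ℝ, IsSolution W ψ → totalEnergy W ψ 0 ≠ ⊤ →
    ∃ Gp Gm : ℝ → ℝ, RadiationFieldRepresentation1D W ψ Gp Gm

variable {V}

/-- Unfolding `profileEnergy`. [folklore] -/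
theorem profileEnergy_def (G : ℝ → ℝ) (s : Set ℝ) :
    profileEnergy G s = ∫⁻ u in s, ENNReal.ofReal (2 * G u ^ 2) := rfl

/-- The radiated energy is monotone in the window. [folklore] -/
theorem profileEnergy_mono (G : ℝ → ℝ) {s s' : Set ℝ} (h : s ⊆ s') :
    profileEnergy G s ≤ profileEnergy G s' :=
  lintegral_mono_set h

/-- An `L²` profile radiates finite energy: `∫_s 2G² ≤ 2‖G‖₂² < ∞`. [folklore] -/
theorem profileEnergy_lt_top {G : ℝ → ℝ} (hG : MemLp G 2) (s : Set ℝ) : profileEnergy G s < ⊤ := by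
  refine lt_of_le_of_lt (profileEnergy_mono G (subset_univ s)) ?_
  rw [profileEnergy, Measure.restrict_univ]
  have hint : Integrable (fun u ↦ G u ^ 2) := hG.integrable_sq
  have h2 : ∫⁻ u, ENNReal.ofReal (2 * G u ^ 2) = 2 * ∫⁻ u, ENNReal.ofReal (G u ^ 2) := by
    rw [← lintegral_const_mul' _ _ ENNReal.ofNat_ne_top]
    refine lintegral_congr fun u ↦ ?_
    rw [ENNReal.ofReal_mul zero_le_two, ENNReal.ofReal_ofNat]
  rw [h2]
  exact ENNReal.mul_lt_top ENNReal.ofNat_lt_top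
    ((hasFiniteIntegral_iff_ofReal (ae_of_all _ fun u ↦ sq_nonneg (G u))).1 hint.hasFiniteIntegral)

/-- The zero wave is represented by zero profiles (and has zero defect at all times).
[folklore] -/
theorem RadiationFieldRepresentation1D.zero :
    RadiationFieldRepresentation1D V (fun _ _ ↦ 0) (fun _ ↦ 0) (fun _ ↦ 0) where
  memLp_right := MemLp.zero'
  memLp_left := MemLp.zero'
  tendsto_radiationDefect := by
    have h : radiationDefect V (fun _ _ ↦ (0 : ℝ)) (fun _ ↦ 0) (fun _ ↦ 0) = fun _ ↦ 0 := by
      funext t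
      simp [radiationDefect, freeVelocity, freeGradient]
    rw [h]
    exact tendsto_const_nhds

/-- **Free right-movers are represented by `(F′, 0)`**: for the zero potential, if `F′ = G₊ ∈ L²`
then `ψ(t, x) = F(t − x)` has the radiation-field representation `(G₊, 0)`, with identically
vanishing defect (d'Alembert; the outgoing translation representer of Lax–Phillips).
[cite: LaxPhillips1967, Ch. I §5 (5.8)] -/
theorem RadiationFieldRepresentation1D.of_rightMover {F Gp : ℝ → ℝ} (hF : ∀ s, HasDerivAt F (Gp s) s)
    (hGp : MemLp Gp 2) :
    RadiationFieldRepresentation1D (fun _ ↦ 0) (fun t x ↦ F (t - x)) Gp (fun _ ↦ 0) where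
  memLp_right := hGp
  memLp_left := MemLp.zero'
  tendsto_radiationDefect := by
    have h1 : ∀ t x, deriv (fun τ ↦ F (τ - x)) t = Gp (t - x) := fun t x ↦ by
      have := (hasDerivAt_free (F := F) (H := fun _ ↦ 0) (Gm := fun _ ↦ 0) hF
        (fun s ↦ hasDerivAt_const s 0) t x).1
      simp only [add_zero, freeVelocity] at this
      exact this.deriv
    have h2 : ∀ t x, deriv (fun y ↦ F (t - y)) x = -Gp (t - x) := fun t x ↦ by
      have := (hasDerivAt_free (F := F) (H := fun _ ↦ 0) (Gm := fun _ ↦ 0) hF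
        (fun s ↦ hasDerivAt_const s 0) t x).2
      simp only [add_zero, freeGradient] at this
      exact this.deriv
    have : radiationDefect (fun _ ↦ (0 : ℝ)) (fun t x ↦ F (t - x)) Gp (fun _ ↦ 0) = fun _ ↦ 0 := by
      funext t
      simp [radiationDefect, freeVelocity, freeGradient, h1, h2]
    rw [this]
    exact tendsto_const_nhds

/-- From asymptotic completeness, every finite-energy solution has a representation (restated for
dot-notation use). [folklore] -/
theorem AsymptoticallyComplete.exists_rep (h : AsymptoticallyComplete V) {ψ : ℝ → ℝ → ℝ}
    (hψ : IsSolution V ψ) (hE : totalEnergy V ψ 0 ≠ ⊤) :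
    ∃ Gp Gm : ℝ → ℝ, RadiationFieldRepresentation1D V ψ Gp Gm :=
  h ψ hψ hE

/-! ### The distorted-Fourier radiation integral and the windowed quadratic forms -/

/-- The **radiation integral** of a real spectral density `c` against a real phase `θ`:
`Z(u) = ∫ c(ω) e^{i(θ(ω) − ω u)} dω` (Bochner integral over `ℝ`; `c` is meant to vanish for `ω ≤ 0`,
and the integral is `0` by convention when `c` is not integrable).  The form in which a radiation
profile appears when time-symmetric data are expanded in the standing waves `cos(ωx + θ(ω))` of the
stationary problem. [folklore] -/
def radiationIntegral (c θ : ℝ → ℝ) (u : ℝ) : ℂ :=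
  ∫ ω, (c ω : ℂ) * Complex.exp (Complex.I * ((θ ω : ℂ) - (ω : ℂ) * (u : ℂ)))

/-- The **windowed norm** `A(u₀) = ∫_{u ≤ u₀} ‖Z(u)‖² du` of a complex profile (the energy, up to
the factor conventions of `profileEnergy`, radiated before retarded time `u₀`). [folklore] -/
def windowedNorm (Z : ℝ → ℂ) (u₀ : ℝ) : ℝ := ∫ u in Iic u₀, ‖Z u‖ ^ 2

/-- The **windowed interference form** `B(u₀) = Re ∫_{u ≤ u₀} Z(u)² du`. [folklore] -/
def windowedInterference (Z : ℝ → ℂ) (u₀ : ℝ) : ℝ := (∫ u in Iic u₀, Z u ^ 2).re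

/-- `2 (Im z)² = ‖z‖² − Re(z²)`. [folklore] -/
theorem two_mul_im_sq (z : ℂ) : 2 * z.im ^ 2 = ‖z‖ ^ 2 - (z ^ 2).re := by
  rw [Complex.sq_norm, Complex.normSq_apply, pow_two z, Complex.mul_re]
  ring

/-- `2 (Re z)² = ‖z‖² + Re(z²)`. [folklore] -/
theorem two_mul_re_sq (z : ℂ) : 2 * z.re ^ 2 = ‖z‖ ^ 2 + (z ^ 2).re := by
  rw [Complex.sq_norm, Complex.normSq_apply, pow_two z, Complex.mul_re]
  ring

/-- **Caught energy of the `Im`-profile = `A − B`**: if `‖Z‖²` is integrable on `{u ≤ u₀}` (and `Z`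
is measurable there), then `2 ∫_{u ≤ u₀} (Im Z)² = A(u₀) − B(u₀)`. [folklore] -/
theorem two_mul_integral_im_sq {Z : ℝ → ℂ} {u₀ : ℝ}
    (hZ : AEStronglyMeasurable Z (volume.restrict (Iic u₀)))
    (hint : IntegrableOn (fun u ↦ ‖Z u‖ ^ 2) (Iic u₀)) :
    2 * ∫ u in Iic u₀, (Z u).im ^ 2 = windowedNorm Z u₀ - windowedInterference Z u₀ := by
  have hsq : IntegrableOn (fun u ↦ Z u ^ 2) (Iic u₀) := by
    refine ⟨hZ.pow 2, ?_⟩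
    refine hint.hasFiniteIntegral.congr' (ae_of_all _ fun u ↦ ?_)
    simp [norm_pow]
  have hre : IntegrableOn (fun u ↦ (Z u ^ 2).re) (Iic u₀) := hsq.re
  have h1 : ∫ u in Iic u₀, (Z u ^ 2).re = (∫ u in Iic u₀, Z u ^ 2).re := by
    simpa only [RCLike.re_to_complex] using integral_re hsq
  rw [windowedNorm, windowedInterference, ← h1, ← integral_sub hint hre, ← integral_const_mul]
  refine integral_congr_ae (ae_of_all _ fun u ↦ ?_)
  exact two_mul_im_sq (Z u)

/-- **Caught energy of the `Re`-profile = `A + B`**: under the same hypotheses,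
`2 ∫_{u ≤ u₀} (Re Z)² = A(u₀) + B(u₀)`. [folklore] -/
theorem two_mul_integral_re_sq {Z : ℝ → ℂ} {u₀ : ℝ}
    (hZ : AEStronglyMeasurable Z (volume.restrict (Iic u₀)))
    (hint : IntegrableOn (fun u ↦ ‖Z u‖ ^ 2) (Iic u₀)) :
    2 * ∫ u in Iic u₀, (Z u).re ^ 2 = windowedNorm Z u₀ + windowedInterference Z u₀ := by
  have hsq : IntegrableOn (fun u ↦ Z u ^ 2) (Iic u₀) := by
    refine ⟨hZ.pow 2, ?_⟩
    refine hint.hasFiniteIntegral.congr' (ae_of_all _ fun u ↦ ?_)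
    simp [norm_pow]
  have hre : IntegrableOn (fun u ↦ (Z u ^ 2).re) (Iic u₀) := hsq.re
  have h1 : ∫ u in Iic u₀, (Z u ^ 2).re = (∫ u in Iic u₀, Z u ^ 2).re := by
    simpa only [RCLike.re_to_complex] using integral_re hsq
  rw [windowedNorm, windowedInterference, ← h1, ← integral_add hint hre, ← integral_const_mul]
  refine integral_congr_ae (ae_of_all _ fun u ↦ ?_)
  exact two_mul_re_sq (Z u)

/-- `|B| ≤ A`: the interference form is dominated by the windowed norm. [folklore] -/
theorem abs_windowedInterference_le {Z : ℝ → ℂ} {u₀ : ℝ} :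
    |windowedInterference Z u₀| ≤ windowedNorm Z u₀ := by
  rw [windowedInterference, windowedNorm]
  refine (Complex.abs_re_le_norm _).trans ?_
  refine (norm_integral_le_integral_norm _).trans (le_of_eq ?_)
  refine integral_congr_ae (ae_of_all _ fun u ↦ ?_)
  simp [norm_pow]

end Scattering1D

end Literature.Analysis.ODE
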